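import Summits.PneNP.PneNP.Theorems.ConvexRankGatesLinAlgGateBlindFacetTrdeg
import Mathlib.RingTheory.MvPolynomial.Basic
import Mathlib.RingTheory.Adjoin.Basic

/-!
# Route ConvexRankGates, crux `LinAlgGateBlind` (stmt-PneNP-10681): facet count for linear pencils, IV — the transcendence potential and transport

Support lemmas for the crux (vocabulary of `Theorems/ConvexRankGatesLinAlgGateBlindDefs.lean`); fourth file of the
facet count for linear pencils `M_W = ∑_{i ∈ W} Xᵢ Kᵢ` (see `…FacetKernel`, `…FacetSubst`, `…FacetTrdeg`). The
POTENTIAL of a sub-pencil `D` with kernel vector `u_D ∈ F[X]^d` is `t(D) := trdeg_F F[(u_D)_1, …, (u_D)_d]`, the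
transcendence degree of the `F`-algebra generated by the entries of the kernel vector:

* `exists_algHom_adjoin_surjective`, `trdeg_adjoin_range_comp_le` — an `F`-algebra endomorphism `σ` of `F[X]` (the
  specialisation `D' ↝ D` killing variables) maps `F[u']` ONTO `F[σ ∘ u']`, so the potential is MONOTONE:
  `t(D) ≤ t(D')` when `u_D = σ(u_{D'})`;
* `trdeg_adjoin_range_le_card` — it is BOUNDED: `t(D) ≤ d`;
* `exists_coeff_of_trdeg_eq` — **transport**: if `u'` is a kernel vector of `M_{D+i}` (`i ∉ D`), `u = σ_D(u')`
  entrywise and `t(D) = t(D+i)`, then `K_i` acts on `u` like an element of the pencil of `D` over the fraction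
  field: `K_i u = ∑_{j ∈ D} c_j K_j u` for some `c_j ∈ Frac F[X]`. Indeed upstairs `M_{D+i} u' = 0` solves the
  linear system `∑_j c_j (K_j u') = K_i u'` (coefficients in `F[u']`) by `c_j = -X_j/X_i`; the specialisation
  `F[u'] ↠ F[u]` is injective by `algHom_injective_of_surjective_of_trdeg_eq`, and solvability transfers along it
  (`exists_mulVec_eq_transfer`).

Sources: [folklore]; the rigidity argument is the tree's. No new definitions. [folklore]
-/

-- `Summit.PneNP.PneNP.…` duplicates `PneNP` BY DESIGN (single-problem summit).
set_option linter.dupNamespace false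

namespace Summit.PneNP.PneNP.Theorems

open Finset Matrix MvPolynomial

/-! ### The potential: monotone and bounded -/

section Potential

variable {F : Type*} [Field F] {R : Type*} [CommRing R] [Algebra F R] {κ : Type*}

/-- An `F`-algebra endomorphism `σ` restricts to a SURJECTION from `F[u']` onto `F[u]` when `u = σ ∘ u'`.
[folklore] -/
theorem exists_algHom_adjoin_surjective (σ : R →ₐ[F] R) (u' u : κ → R) (hu : ∀ b, σ (u' b) = u b) :
    ∃ ψ : Algebra.adjoin F (Set.range u') →ₐ[F] Algebra.adjoin F (Set.range u),
      Function.Surjective ψ ∧ ∀ x, (ψ x : R) = σ x := by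
  set S' : Subalgebra F R := Algebra.adjoin F (Set.range u') with hS'
  set S : Subalgebra F R := Algebra.adjoin F (Set.range u) with hS
  have hmap : S'.map σ = S := by
    rw [hS', AlgHom.map_adjoin, ← Set.range_comp, hS]
    congr 1
    ext x
    constructor
    · rintro ⟨b, rfl⟩
      exact ⟨b, (hu b).symm⟩
    · rintro ⟨b, rfl⟩
      exact ⟨b, hu b⟩
  have hmem : ∀ x : S', σ x ∈ S := fun x => by
    rw [← hmap]
    exact Subalgebra.mem_map.2 ⟨x, x.2, rfl⟩
  refine ⟨(σ.comp S'.val).codRestrict S hmem, ?_, fun x => rfl⟩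
  rintro ⟨y, hy⟩
  rw [← hmap] at hy
  obtain ⟨x, hx, hxy⟩ := Subalgebra.mem_map.1 hy
  exact ⟨⟨x, hx⟩, Subtype.ext hxy⟩

/-- **The potential is monotone under specialisation**: `trdeg_F F[u] ≤ trdeg_F F[u']` when `u = σ ∘ u'` for an
`F`-algebra endomorphism `σ`. [folklore] -/
theorem trdeg_adjoin_range_comp_le (σ : R →ₐ[F] R) (u' u : κ → R) (hu : ∀ b, σ (u' b) = u b) :
    Algebra.trdeg F (Algebra.adjoin F (Set.range u)) ≤ Algebra.trdeg F (Algebra.adjoin F (Set.range u')) := by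
  obtain ⟨ψ, hψ, -⟩ := exists_algHom_adjoin_surjective σ u' u hu
  exact trdeg_le_of_surjective ψ hψ

/-- **The potential is bounded**: the `F`-algebra generated by finitely many elements `u_b`, `b : κ`, of a domain has
transcendence degree at most `#κ`. [folklore] -/
theorem trdeg_adjoin_range_le_card [IsDomain R] [Fintype κ] (u : κ → R) :
    Algebra.trdeg F (Algebra.adjoin F (Set.range u)) ≤ Fintype.card κ := by
  classical
  set S : Subalgebra F R := Algebra.adjoin F (Set.range u) with hS
  set gen : κ → S := fun b => ⟨u b, Algebra.subset_adjoin (Set.mem_range_self b)⟩ with hgen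
  have htop : Algebra.adjoin F (Set.range gen) = ⊤ := by
    have h := Algebra.adjoin_adjoin_coe_preimage (R := F) (s := Set.range u)
    have hset : ((Subtype.val : S → R) ⁻¹' Set.range u) = Set.range gen := by
      ext x
      constructor
      · rintro ⟨b, hb⟩
        exact ⟨b, Subtype.ext hb⟩
      · rintro ⟨b, rfl⟩
        exact ⟨b, rfl⟩
    rw [hset] at h
    exact h
  haveI : Algebra.IsAlgebraic (Algebra.adjoin F (Set.range gen)) S := by
    rw [htop]
    exact ⟨fun x => by
      simpa using isAlgebraic_algebraMap (R := (⊤ : Subalgebra F S)) (A := S) ⟨x, Algebra.mem_top⟩⟩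
  calc Algebra.trdeg F S ≤ Cardinal.mk (Set.range gen) := Algebra.IsAlgebraic.trdeg_le_cardinalMk F (Set.range gen)
    _ = Fintype.card (Set.range gen) := Cardinal.mk_fintype _
    _ ≤ Fintype.card κ := by exact_mod_cast Fintype.card_range_le gen

end Potential

/-! ### Transport of the criterion along a potential-preserving extension -/

section Transport

variable {F : Type*} [Field F] {ι : Type*} [DecidableEq ι] {d : ℕ}

/-- **Transport.** Let `i ∉ D`, let `u'` be a kernel vector of the pencil `M_{D+i} = ∑_{j ∈ D+i} X_j K_j` over
`F[X]`, and let `u` be its specialisation `X_k ↦ 0` (`k ∉ D`). If `trdeg_F F[u] = trdeg_F F[u'] < ℵ₀` then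
`K_i u = ∑_{j ∈ D} c_j K_j u` for some `c_j ∈ Frac F[X]`. Proof: the row identities of `M_{D+i} u' = 0` say that
`c_j = -X_j/X_i` solves `∑_{j∈D} c_j (K_j u')_a = (K_i u')_a` (`a = 1..d`), a system with coefficients in `F[u']`;
the specialisation `F[u'] ↠ F[u]` is injective (`algHom_injective_of_surjective_of_trdeg_eq`), so the specialised
system `∑_j c_j (K_j u)_a = (K_i u)_a` is solvable over `Frac F[X]` (`exists_mulVec_eq_transfer`). [folklore] -/
theorem exists_coeff_of_trdeg_eq : ∀ {F : Type*} [Field F] {ι : Type*} [DecidableEq ι] {d : ℕ}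
    (K : ι → Matrix (Fin d) (Fin d) F) (D : Finset ι) (i : ι), i ∉ D →
    ∀ (u' u : Fin d → MvPolynomial ι F),
    (∀ b, u b = MvPolynomial.aeval (R := F) (fun k => if k ∈ D then (X k : MvPolynomial ι F) else 0) (u' b)) →
    (∑ j ∈ insert i D, (X j : MvPolynomial ι F) • (K j).map (C : F →+* MvPolynomial ι F)) *ᵥ u' = 0 →
    Algebra.trdeg F (Algebra.adjoin F (Set.range u)) = Algebra.trdeg F (Algebra.adjoin F (Set.range u')) →
    Algebra.trdeg F (Algebra.adjoin F (Set.range u)) < Cardinal.aleph0 →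
    ∃ c : ι → FractionRing (MvPolynomial ι F),
      ((K i).map ((algebraMap (MvPolynomial ι F) (FractionRing (MvPolynomial ι F))).comp C) -
          ∑ j ∈ D, c j • (K j).map ((algebraMap (MvPolynomial ι F) (FractionRing (MvPolynomial ι F))).comp C)) *ᵥ
        (fun b => algebraMap (MvPolynomial ι F) (FractionRing (MvPolynomial ι F)) (u b)) = 0 := by
  intro F _ ι _ d K D i hi u' u hu hker htr hfin
  classical
  set L := FractionRing (MvPolynomial ι F) with hL
  set φ := algebraMap (MvPolynomial ι F) L with hφ
  have hφinj : Function.Injective φ := IsFractionRing.injective (MvPolynomial ι F) L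
  set σ : MvPolynomial ι F →ₐ[F] MvPolynomial ι F :=
    MvPolynomial.aeval fun k => if k ∈ D then (X k : MvPolynomial ι F) else 0 with hσ
  have hσu : ∀ b, σ (u' b) = u b := fun b => (hu b).symm
  -- the specialisation `F[u'] ↠ F[u]` is injective
  obtain ⟨ψ, hψsurj, hψval⟩ := exists_algHom_adjoin_surjective σ u' u hσu
  have hψinj : Function.Injective ψ :=
    algHom_injective_of_surjective_of_trdeg_eq ψ hψsurj hfin htr.symm
  -- the linear system `∑_{j ∈ D} c_j (K_j u')_a = (K_i u')_a` with coefficients in `S'`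
  have hmemC : ∀ (j : ι) (a : Fin d),
      ((K j).map (C : F →+* MvPolynomial ι F) *ᵥ u') a ∈ Algebra.adjoin F (Set.range u') := by
    intro j a
    simp only [mulVec, dotProduct, Matrix.map_apply]
    refine Subalgebra.sum_mem _ fun b _ => Subalgebra.mul_mem _ ?_ (Algebra.subset_adjoin (Set.mem_range_self b))
    rw [← MvPolynomial.algebraMap_eq]
    exact Subalgebra.algebraMap_mem _ _
  set Coef : Matrix (Fin d) D (Algebra.adjoin F (Set.range u')) := fun a j =>
    ⟨((K j).map (C : F →+* MvPolynomial ι F) *ᵥ u') a, hmemC j a⟩ with hCoef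
  set rhs : Fin d → Algebra.adjoin F (Set.range u') := fun a => ⟨((K i).map (C : F →+* MvPolynomial ι F) *ᵥ u') a, hmemC i a⟩ with hrhs
  -- two embeddings of `S'` into `L`
  set f : Algebra.adjoin F (Set.range u') →+* L :=
    φ.comp ((Algebra.adjoin F (Set.range u')).val : Algebra.adjoin F (Set.range u') →+* MvPolynomial ι F)
    with hf
  set g : Algebra.adjoin F (Set.range u') →+* L :=
    φ.comp ((((Algebra.adjoin F (Set.range u)).val :
      Algebra.adjoin F (Set.range u) →+* MvPolynomial ι F)).comp
        (ψ : Algebra.adjoin F (Set.range u') →+* Algebra.adjoin F (Set.range u))) with hg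
  have hfinj : Function.Injective f := hφinj.comp Subtype.val_injective
  have hginj : Function.Injective g := hφinj.comp (Subtype.val_injective.comp hψinj)
  have hgapply : ∀ x : Algebra.adjoin F (Set.range u'), g x = φ (σ x) := fun x => by
    rw [hg, RingHom.comp_apply, RingHom.comp_apply]
    exact congr_arg φ (hψval x)
  -- solvable along `f`: `c_j = -X_j / X_i`
  have hXi : φ (X i) ≠ 0 := fun h => (MvPolynomial.X_ne_zero (R := F) i) (hφinj (by rw [h, map_zero]))
  have hrow : ∀ a, (X i : MvPolynomial ι F) * ((K i).map (C : F →+* MvPolynomial ι F) *ᵥ u') a +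
      ∑ j ∈ D, (X j : MvPolynomial ι F) * ((K j).map (C : F →+* MvPolynomial ι F) *ᵥ u') a = 0 := by
    intro a
    have h := congr_fun hker a
    rw [Matrix.sum_mulVec, Finset.sum_apply, Finset.sum_insert hi, Pi.zero_apply] at h
    simpa only [Matrix.smul_mulVec, Pi.smul_apply, smul_eq_mul] using h
  have hsol : ∃ x : D → L, Coef.map f *ᵥ x = fun a => f (rhs a) := by
    refine ⟨fun j => -(φ (X (j : ι)) / φ (X i)), funext fun a => ?_⟩
    have h := congr_arg φ (hrow a)
    rw [map_add, map_mul, map_sum, map_zero] at h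
    simp only [map_mul] at h
    simp only [mulVec, dotProduct, Matrix.map_apply, hf, hCoef, hrhs, RingHom.comp_apply]
    change ∑ j : D, φ (((K j).map (C : F →+* MvPolynomial ι F) *ᵥ u') a) * -(φ (X (j : ι)) / φ (X i)) =
      φ (((K i).map (C : F →+* MvPolynomial ι F) *ᵥ u') a)
    rw [Finset.sum_coe_sort D (fun j => φ (((K j).map (C : F →+* MvPolynomial ι F) *ᵥ u') a) *
      -(φ (X j) / φ (X i)))]
    have h' : φ (((K i).map (C : F →+* MvPolynomial ι F) *ᵥ u') a) =
        -(∑ j ∈ D, φ (X j) * φ (((K j).map (C : F →+* MvPolynomial ι F) *ᵥ u') a)) / φ (X i) := by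
      rw [eq_div_iff hXi]
      linear_combination h
    rw [h', eq_div_iff hXi, Finset.sum_mul, ← Finset.sum_neg_distrib]
    refine Finset.sum_congr rfl fun j _ => ?_
    rw [show φ (((K j).map (C : F →+* MvPolynomial ι F) *ᵥ u') a) * -(φ (X j) / φ (X i)) * φ (X i) =
      -(φ (X j) / φ (X i) * φ (X i) * φ (((K j).map (C : F →+* MvPolynomial ι F) *ᵥ u') a)) by ring,
      div_mul_cancel₀ _ hXi]
  -- transfer along `g`
  obtain ⟨x, hx⟩ := exists_mulVec_eq_transfer f g hfinj hginj Coef rhs hsol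
  have hσK : ∀ (j : ι) (a : Fin d), σ (((K j).map (C : F →+* MvPolynomial ι F) *ᵥ u') a) =
      ((K j).map (C : F →+* MvPolynomial ι F) *ᵥ u) a := by
    intro j a
    simp only [mulVec, dotProduct, Matrix.map_apply, map_sum, map_mul, MvPolynomial.algHom_C,
      MvPolynomial.algebraMap_eq, hσu]
  refine ⟨fun j => if h : j ∈ D then x ⟨j, h⟩ else 0, funext fun a => ?_⟩
  have hxa := congr_fun hx a
  simp only [mulVec, dotProduct, Matrix.map_apply, hgapply] at hxa
  change ∑ j : D, φ (σ (((K j).map (C : F →+* MvPolynomial ι F) *ᵥ u') a)) * x j =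
    φ (σ (((K i).map (C : F →+* MvPolynomial ι F) *ᵥ u') a)) at hxa
  simp only [hσK] at hxa
  -- unfold the goal to the same scalar identity
  have hKφ : ∀ j : ι, ((K j).map (φ.comp C) *ᵥ fun b => φ (u b)) a =
      φ (((K j).map (C : F →+* MvPolynomial ι F) *ᵥ u) a) := by
    intro j
    rw [RingHom.map_mulVec, Matrix.map_map]
    rfl
  rw [Pi.zero_apply, sub_mulVec, Pi.sub_apply, Matrix.sum_mulVec, Finset.sum_apply, hKφ, ← hxa, sub_eq_zero,
    ← Finset.sum_coe_sort D]
  refine (Finset.sum_congr rfl fun j _ => ?_).symm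
  rw [Matrix.smul_mulVec, Pi.smul_apply, smul_eq_mul, hKφ, mul_comm]
  simp only [dif_pos j.2]

end Transport

end Summit.PneNP.PneNP.Theorems
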